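import Literature.Analysis.Fourier.FejerKernelDerivativePair
import Mathlib.Analysis.SpecialFunctions.Integrals.LogTrigonometric
import Mathlib.Analysis.SpecialFunctions.Log.NegMulLog
import Mathlib.MeasureTheory.Integral.Prod
import HarnessLib

/-!
# Ramaré's Lemma 17 (upper-bound form): `Σ_{n≥1} K(δn)/n ≤ −log(2πδ) + 3/2 + (πδ)²/(6(6 − (πδ)²))`

Everything here is PROVED (theorems only).  With `K(x) = sinc²(πx)` and
`K'(x) = −4π∫₀¹(1−t)t sin(2πxt)dt` (`FejerKernelDerivativePair`), we follow Ramaré's proof of his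
Lemma 17 (Acta Arith. 100 (2001), pp. 260–261) for `f(δ) = Σ_{n≥1} K(δn)/n`:

* `hasSum_sinc_sq_deriv` — (5.5): `Σ_{n≥1} K'(δn) = −2π∫₀¹ (1−t)t cot(πδt) dt` for `0 < δ < 1`
  (conjugate Dirichlet kernel `two_mul_sin_mul_sum_sin`, and the cosine Riemann–Lebesgue lemma
  `tendsto_integral_Ioi_mul_cos_atTop`);
* `hasDerivAt_tsum_sinc_sq_div` (`f' = Σ K'(δn)`), `tsum_sinc_sq_div_one` (`f(1) = 0`);
* `tsum_sinc_sq_div_eq_integral` — integrating in `δ` (FTC, Fubini, and the inner primitive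
  `log sin(πst)`): `f(δ) = 2∫₀¹(1−t) log sin(πt) dt − 2∫₀¹(1−t) log sin(πδt) dt`;
* `two_mul_integral_one_sub_mul_log_sin` — (5.6): `2∫₀¹(1−t) log sin(πt) dt = −log 2`
  (Mathlib's `integral_log_sin_zero_pi`);
* `neg_two_mul_integral_log_sin_le` — the substitute for Lemma 18: from `sin u ≥ u − u³/6`
  (`sub_cube_div_six_le_sin`), `−2∫₀¹(1−t) log sin(xt) dt ≤ −log x + 3/2 + x²/(6(6 − x²))`;
* **`tsum_sinc_sq_div_le`**: for `0 < δ ≤ 1/2`,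
  `Σ_{n≥1} K(δn)/n ≤ −log(2πδ) + 3/2 + (πδ)²/(6(6 − (πδ)²))`.

Ramaré's exact statement is `f(δ) = −log δ + 3/2 − log 2π + 2∫₀¹(1−t)log(πδt/sin πδt)dt` with the
last term `≤ π³δ²/12` (Lemma 18); the bound proved here (`≤ (πδ)²/(6(6−(πδ)²))`) is what the odd case
of Corollary 1 consumes.

## References

* O. Ramaré, *Approximate formulae for L(1,χ)*, Acta Arith. 100 (2001) 245–266, Lemma 17 and
  (5.4)–(5.6) pp. 260–261, Lemma 18 p. 261. [cite: Ramare2001LOneApproximateFormulae, Lemma 17 p. 260]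
-/

noncomputable section

open Real Filter Topology Set MeasureTheory intervalIntegral

namespace Literature.Analysis.Fourier

/-! ## Riemann–Lebesgue (cosine form) and the conjugate Dirichlet kernel -/

/-- **Riemann–Lebesgue lemma, cosine form**: for `h` integrable on `(0, ∞)`,
`∫₀^∞ h(u) cos(Tu) du → 0` as `T → +∞` (the step «the Riemann–Lebesgue lemma gives us (5.5)»).
[cite: Ramare2001LOneApproximateFormulae, Lemma 17 p. 260 (proof, (5.5))] -/
theorem tendsto_integral_Ioi_mul_cos_atTop {h : ℝ → ℝ} (hh : IntegrableOn h (Ioi 0)) :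
    Tendsto (fun T : ℝ => ∫ u in Ioi (0 : ℝ), h u * Real.cos (T * u)) atTop (𝓝 0) := by
  set f : ℝ → ℂ := (Ioi (0 : ℝ)).indicator (fun u => (h u : ℂ)) with hf
  have hRL := Real.tendsto_integral_exp_smul_cocompact f
  have hT : Tendsto (fun T : ℝ => -T / (2 * π)) atTop (cocompact ℝ) :=
    (tendsto_neg_atTop_atBot.atBot_div_const (by positivity)).mono_right atBot_le_cocompact
  have h2 := hRL.comp hT
  have h3 : ∀ T : ℝ, (∫ v, Real.fourierChar (-(v * (-T / (2 * π)))) • f v) =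
      ∫ u in Ioi (0 : ℝ), Complex.exp (↑(T * u) * Complex.I) * (h u : ℂ) := by
    intro T
    rw [← MeasureTheory.integral_indicator measurableSet_Ioi]
    congr 1; ext v
    rw [hf]
    by_cases hv : v ∈ Ioi (0 : ℝ)
    · rw [indicator_of_mem hv, indicator_of_mem hv, Circle.smul_def, Real.fourierChar_apply,
        smul_eq_mul]
      congr 2
      push_cast
      field_simp
    · rw [indicator_of_notMem hv, indicator_of_notMem hv, smul_zero]
  have h4 : Tendsto (fun T : ℝ => ∫ u in Ioi (0 : ℝ), Complex.exp (↑(T * u) * Complex.I) * (h u : ℂ))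
      atTop (𝓝 0) := h2.congr h3
  have h5 := (Complex.continuous_re.tendsto 0).comp h4
  simp only [Complex.zero_re] at h5
  refine h5.congr fun T => ?_
  have hint : Integrable (fun u => Complex.exp (↑(T * u) * Complex.I) * (h u : ℂ))
      (volume.restrict (Ioi 0)) :=
    Integrable.bdd_mul hh.ofReal (Continuous.aestronglyMeasurable (by fun_prop))
      (Eventually.of_forall fun u => by rw [Complex.norm_exp_ofReal_mul_I])
  have := integral_re hint
  simp only [RCLike.re_to_complex, Function.comp] at this ⊢
  rw [← this]
  congr 1; ext u
  rw [Complex.re_mul_ofReal, Complex.exp_ofReal_mul_I_re]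
  ring

/-- **Conjugate Dirichlet kernel**: `2 sin θ · Σ_{k<N} sin(2(k+1)θ) = cos θ − cos((2N+1)θ)`
(the geometric sum evaluated in Ramaré's proof of Lemma 17, between (5.4) and (5.5)).
[cite: Ramare2001LOneApproximateFormulae, Lemma 17 p. 260 (proof)] -/
theorem two_mul_sin_mul_sum_sin (θ : ℝ) (N : ℕ) :
    2 * Real.sin θ * ∑ k ∈ Finset.range N, Real.sin (2 * ((k:ℝ) + 1) * θ)
      = Real.cos θ - Real.cos ((2 * N + 1) * θ) := by
  induction N with
  | zero => simp
  | succ N ih =>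
    rw [Finset.sum_range_succ, mul_add, ih, Real.two_mul_sin_mul_sin]
    push_cast
    rw [show θ - 2 * ((N:ℝ) + 1) * θ = -((2 * N + 1) * θ) by ring, Real.cos_neg,
      show θ + 2 * ((N:ℝ) + 1) * θ = (2 * (N + 1) + 1) * θ by ring]
    ring

/-! ## Bounds for `t(1−t)/sin(πst)` -/

/-- For `0 < s ≤ 1` and `t ∈ [0,1]`: `2st(1−t) ≤ sin(πst)`. [folklore] -/
private theorem two_mul_mul_le_sin {s t : ℝ} (hs : 0 < s) (hs1 : s ≤ 1) (ht0 : 0 ≤ t) (ht1 : t ≤ 1) :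
    2 * s * t * (1 - t) ≤ Real.sin (π * (s * t)) := by
  have hst1 : s * t ≤ 1 := by nlinarith
  have h := mul_one_sub_le_half_sin (mul_nonneg hs.le ht0) hst1
  -- st(1 − st) ≤ sin/2 and 1 − st ≥ 1 − t
  have h2 : s * t * (1 - t) ≤ s * t * (1 - s * t) := by
    apply mul_le_mul_of_nonneg_left _ (mul_nonneg hs.le ht0); nlinarith
  linarith

/-- Bounded measurable functions are interval integrable on `[0,1]`. [folklore] -/
private theorem intervalIntegrable_of_abs_le' {f : ℝ → ℝ} (hf : Measurable f) {C : ℝ}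
    (h : ∀ t ∈ Ioo (0:ℝ) 1, |f t| ≤ C) : IntervalIntegrable f volume 0 1 := by
  rw [intervalIntegrable_iff_integrableOn_Ioo_of_le zero_le_one]
  refine Measure.integrableOn_of_bounded (M := C) measure_Ioo_lt_top.ne hf.aestronglyMeasurable ?_
  rw [ae_restrict_iff' measurableSet_Ioo]
  exact Eventually.of_forall fun t ht => by rw [Real.norm_eq_abs]; exact h t ht

/-- `|(1−t)t·g/sin(πst)| ≤ 1/(2s)` for `t ∈ (0,1)`, `0 < s ≤ 1`, `|g| ≤ 1`. [folklore] -/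
private theorem abs_kernel_div_sin_le {s t g : ℝ} (hs : 0 < s) (hs1 : s ≤ 1) (ht : t ∈ Ioo (0:ℝ) 1)
    (hg : |g| ≤ 1) : |(1 - t) * t * g / Real.sin (π * (s * t))| ≤ 1 / (2 * s) := by
  have hsin := two_mul_mul_le_sin hs hs1 ht.1.le ht.2.le
  have hpos : 0 < 2 * s * t * (1 - t) := by
    have := ht.1; have := ht.2; positivity
  have hsinpos : 0 < Real.sin (π * (s * t)) := lt_of_lt_of_le hpos hsin
  rw [abs_div, abs_of_pos hsinpos, div_le_div_iff₀ hsinpos (by positivity), abs_mul,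
    abs_of_nonneg (by nlinarith [ht.1, ht.2] : 0 ≤ (1 - t) * t)]
  calc (1 - t) * t * |g| * (2 * s) ≤ (1 - t) * t * 1 * (2 * s) := by gcongr; nlinarith [ht.1, ht.2]
    _ = 2 * s * t * (1 - t) := by ring
    _ ≤ 1 * Real.sin (π * (s * t)) := by linarith

/-! ## Partial sums of `Σ K'(δn)` and their limit -/

/-- **Partial sums**: for `0 < δ < 1`,
`Σ_{n<N} K'(δ(n+1)) = −2π∫₀¹ (1−t)t cot(πδt) dt + 2π∫₀¹ (1−t)t cos((2N+1)πδt)/sin(πδt) dt`.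
[cite: Ramare2001LOneApproximateFormulae, Lemma 17 p. 260 (proof)] -/
theorem sum_sinc_sq_deriv_eq {δ : ℝ} (hδ : 0 < δ) (hδ1 : δ < 1) (N : ℕ) :
    ∑ n ∈ Finset.range N,
        -(4 * π * ∫ t in (0:ℝ)..1, (1 - t) * t * Real.sin (2 * π * (δ * (n + 1)) * t))
      = -(2 * π * ∫ t in (0:ℝ)..1, (1 - t) * t * Real.cos (π * (δ * t)) / Real.sin (π * (δ * t)))
        + 2 * π * ∫ t in (0:ℝ)..1,
          (1 - t) * t * Real.cos ((2 * N + 1) * (π * (δ * t))) / Real.sin (π * (δ * t)) := by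
  have hi : ∀ n : ℕ, IntervalIntegrable
      (fun t => (1 - t) * t * Real.sin (2 * π * (δ * (n + 1)) * t)) volume (0:ℝ) 1 := fun n =>
    (by fun_prop : Continuous fun t : ℝ => (1 - t) * t * Real.sin (2 * π * (δ * (n + 1)) * t))
      |>.intervalIntegrable _ _
  have h1 : ∑ n ∈ Finset.range N,
      -(4 * π * ∫ t in (0:ℝ)..1, (1 - t) * t * Real.sin (2 * π * (δ * (n + 1)) * t))
      = -(4 * π) * ∫ t in (0:ℝ)..1,
          ∑ n ∈ Finset.range N, (1 - t) * t * Real.sin (2 * π * (δ * (n + 1)) * t) := by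
    rw [intervalIntegral.integral_finsetSum fun n _ => hi n, Finset.mul_sum]
    exact Finset.sum_congr rfl fun n _ => by ring
  -- pointwise kernel identity on `[0,1]`
  have hpt : ∀ t ∈ uIcc (0:ℝ) 1,
      ∑ n ∈ Finset.range N, (1 - t) * t * Real.sin (2 * π * (δ * (n + 1)) * t)
        = (1 - t) * t * Real.cos (π * (δ * t)) / Real.sin (π * (δ * t)) / 2
          - (1 - t) * t * Real.cos ((2 * N + 1) * (π * (δ * t))) / Real.sin (π * (δ * t)) / 2 := by
    intro t ht
    rw [uIcc_of_le zero_le_one] at ht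
    rcases ht.1.eq_or_lt with h0 | h0
    · rw [← h0]; simp
    · have hsin : 0 < Real.sin (π * (δ * t)) := by
        apply Real.sin_pos_of_pos_of_lt_pi (by positivity)
        calc π * (δ * t) ≤ π * (δ * 1) := by gcongr; exact ht.2
          _ < π * 1 := by rw [mul_one]; gcongr
          _ = π := mul_one π
      rw [← Finset.mul_sum]
      have hk := two_mul_sin_mul_sum_sin (π * (δ * t)) N
      have hsum : ∑ k ∈ Finset.range N, Real.sin (2 * ((k:ℝ) + 1) * (π * (δ * t)))
          = ∑ n ∈ Finset.range N, Real.sin (2 * π * (δ * (n + 1)) * t) :=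
        Finset.sum_congr rfl fun k _ => by ring_nf
      rw [hsum] at hk
      have : ∑ n ∈ Finset.range N, Real.sin (2 * π * (δ * (n + 1)) * t)
          = (Real.cos (π * (δ * t)) - Real.cos ((2 * N + 1) * (π * (δ * t))))
            / (2 * Real.sin (π * (δ * t))) := by
        rw [eq_div_iff (by positivity), ← hk]; ring
      rw [this]
      field_simp
  -- integrability of the two pieces (bounded by `1/(2δ)` on `(0,1)`)
  have hb : ∀ (g : ℝ → ℝ), Measurable g → (∀ t, |g t| ≤ 1) → IntervalIntegrable
      (fun t => (1 - t) * t * g t / Real.sin (π * (δ * t))) volume 0 1 := by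
    intro g hgm hg
    refine intervalIntegrable_of_abs_le' (by fun_prop) (C := 1 / (2 * δ)) fun t ht => ?_
    exact abs_kernel_div_sin_le hδ hδ1.le ht (hg t)
  have hI1 := hb (fun t => Real.cos (π * (δ * t))) (by fun_prop) (fun t => Real.abs_cos_le_one _)
  have hI2 := hb (fun t => Real.cos ((2 * N + 1) * (π * (δ * t)))) (by fun_prop)
    (fun t => Real.abs_cos_le_one _)
  rw [h1, intervalIntegral.integral_congr hpt, intervalIntegral.integral_sub (hI1.div_const 2)
    (hI2.div_const 2), intervalIntegral.integral_div, intervalIntegral.integral_div]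
  ring

/-- `Σ K'(δ(n+1))` converges absolutely for `δ > 0`. [cite: Ramare2001LOneApproximateFormulae, Lemma 17 p. 260] -/
theorem summable_sinc_sq_deriv {δ : ℝ} (hδ : 0 < δ) :
    Summable fun n : ℕ =>
      -(4 * π * ∫ t in (0:ℝ)..1, (1 - t) * t * Real.sin (2 * π * (δ * (n + 1)) * t)) := by
  have : Summable fun n : ℕ => 6 / δ ^ 2 * (1 / ((n : ℝ) + 1) ^ 2) := by
    have := (summable_nat_add_iff 1 |>.2 (Real.summable_one_div_nat_pow.2 one_lt_two)).mul_left
      (6 / δ ^ 2)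
    refine this.congr fun n => ?_
    push_cast; ring_nf
  refine Summable.of_norm_bounded this fun n => ?_
  rw [Real.norm_eq_abs, abs_neg]
  refine (abs_sinc_sq_deriv_le_div_one_add_sq _).trans ?_
  rw [mul_one_div, div_div]
  apply div_le_div_of_nonneg_left (by positivity) (by positivity)
  nlinarith [sq_nonneg (δ * ((n:ℝ) + 1)), mul_pos hδ (by positivity : (0:ℝ) < (n:ℝ) + 1)]

/-- **`Σ_{n≥1} K'(δn) = −2π∫₀¹ (1−t)t cot(πδt) dt`** for `0 < δ < 1` (conjugate Dirichlet kernel +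
Riemann–Lebesgue; Ramaré's (5.5)). [cite: Ramare2001LOneApproximateFormulae, (5.5) p. 260] -/
theorem hasSum_sinc_sq_deriv {δ : ℝ} (hδ : 0 < δ) (hδ1 : δ < 1) :
    HasSum (fun n : ℕ =>
        -(4 * π * ∫ t in (0:ℝ)..1, (1 - t) * t * Real.sin (2 * π * (δ * (n + 1)) * t)))
      (-(2 * π * ∫ t in (0:ℝ)..1,
        (1 - t) * t * Real.cos (π * (δ * t)) / Real.sin (π * (δ * t)))) := by
  rw [(summable_sinc_sq_deriv hδ).hasSum_iff_tendsto_nat]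
  simp_rw [sum_sinc_sq_deriv_eq hδ hδ1]
  suffices hI : Tendsto (fun N : ℕ => ∫ t in (0:ℝ)..1,
      (1 - t) * t * Real.cos ((2 * N + 1) * (π * (δ * t))) / Real.sin (π * (δ * t))) atTop (𝓝 0) by
    have h2 := (tendsto_const_nhds (x := -(2 * π * ∫ t in (0:ℝ)..1,
      (1 - t) * t * Real.cos (π * (δ * t)) / Real.sin (π * (δ * t))))).add (hI.const_mul (2 * π))
    rw [mul_zero, add_zero] at h2
    exact h2
  -- Riemann–Lebesgue for `g(t) = (1−t)t/sin(πδt)` on `(0,1)`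
  set g : ℝ → ℝ := fun t => (1 - t) * t / Real.sin (π * (δ * t)) with hg
  have hgm : Measurable g := by simp only [hg]; fun_prop
  have hgi : IntervalIntegrable g volume 0 1 := by
    refine intervalIntegrable_of_abs_le' hgm (C := 1 / (2 * δ)) fun t ht => ?_
    have := abs_kernel_div_sin_le (g := 1) hδ hδ1.le ht (by simp)
    simpa [hg] using this
  have hh : IntegrableOn ((Ioc (0:ℝ) 1).indicator g) (Ioi 0) := by
    rw [IntegrableOn, integrable_indicator_iff measurableSet_Ioc, IntegrableOn,
      Measure.restrict_restrict measurableSet_Ioc, inter_eq_left.2 Ioc_subset_Ioi_self]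
    exact (intervalIntegrable_iff_integrableOn_Ioc_of_le zero_le_one).1 hgi
  have hT : Tendsto (fun N : ℕ => (2 * (N:ℝ) + 1) * (π * δ)) atTop atTop := by
    refine Tendsto.atTop_mul_const (by positivity) ?_
    refine tendsto_atTop_add_const_right _ 1 (Tendsto.const_mul_atTop two_pos ?_)
    exact tendsto_natCast_atTop_atTop
  have hRL := (tendsto_integral_Ioi_mul_cos_atTop hh).comp hT
  refine hRL.congr fun N => ?_
  simp only [Function.comp_def]
  have : (fun u => (Ioc (0:ℝ) 1).indicator g u * Real.cos ((2 * (N:ℝ) + 1) * (π * δ) * u)) =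
      (Ioc (0:ℝ) 1).indicator (fun u => g u * Real.cos ((2 * (N:ℝ) + 1) * (π * δ) * u)) := by
    funext u; rw [indicator_mul_left]
  rw [this, setIntegral_indicator measurableSet_Ioc, inter_eq_right.2 Ioc_subset_Ioi_self,
    ← intervalIntegral.integral_of_le zero_le_one]
  refine intervalIntegral.integral_congr fun t _ => ?_
  simp only [hg]
  rw [show (2 * (N:ℝ) + 1) * (π * δ) * t = (2 * N + 1) * (π * (δ * t)) by ring]
  ring

/-! ## The function `f(δ) = Σ K(δn)/n`: summability, derivative, `f(1) = 0` -/

/-- `Σ K(δ(n+1))/(n+1)` converges for `δ > 0`. [cite: Ramare2001LOneApproximateFormulae, Lemma 17 p. 260] -/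
theorem summable_sinc_sq_div {δ : ℝ} (hδ : 0 < δ) :
    Summable fun n : ℕ => Real.sinc (π * (δ * (n + 1))) ^ 2 / (n + 1) := by
  refine Summable.of_nonneg_of_le (fun n => by positivity) (fun n => ?_)
    ((summable_nat_add_iff 1 |>.2 (Real.summable_one_div_nat_pow.2 (by norm_num : 1 < 3))).mul_left
      (1 / (π ^ 2 * δ ^ 2)))
  have hx : π * (δ * (n + 1)) ≠ 0 := by positivity
  have hsinc : Real.sinc (π * (δ * (n + 1))) ^ 2 ≤ 1 / (π * (δ * (n + 1))) ^ 2 := by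
    rw [Real.sinc_of_ne_zero hx, div_pow]
    gcongr
    nlinarith [Real.sin_sq_le_one (π * (δ * (n + 1)))]
  push_cast
  rw [div_le_iff₀ (by positivity : (0:ℝ) < n + 1)]
  calc Real.sinc (π * (δ * (n + 1))) ^ 2 ≤ 1 / (π * (δ * (n + 1))) ^ 2 := hsinc
    _ = 1 / (π ^ 2 * δ ^ 2) * (1 / ((n : ℝ) + 1) ^ 3) * (n + 1) := by field_simp

/-- **`f'(δ) = Σ K'(δn)`** (term-wise differentiation). [cite: Ramare2001LOneApproximateFormulae, Lemma 17 p. 260 (proof)] -/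
theorem hasDerivAt_tsum_sinc_sq_div {δ : ℝ} (hδ : 0 < δ) :
    HasDerivAt (fun y : ℝ => ∑' n : ℕ, Real.sinc (π * (y * (n + 1))) ^ 2 / (n + 1))
      (∑' n : ℕ, -(4 * π * ∫ t in (0:ℝ)..1, (1 - t) * t * Real.sin (2 * π * (δ * (n + 1)) * t))) δ := by
  set W : ℝ → ℝ := fun x => -(4 * π * ∫ t in (0:ℝ)..1, (1 - t) * t * Real.sin (2 * π * x * t)) with hW
  set term : ℕ → ℝ → ℝ := fun n y => Real.sinc (π * (y * (n + 1))) ^ 2 / (n + 1) with hterm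
  have hderiv : ∀ (n : ℕ) (y : ℝ), HasDerivAt (term n) (W (y * (n + 1))) y := by
    intro n y
    have hn : (0 : ℝ) < n + 1 := by positivity
    have h1 := hasDerivAt_sinc_sq (y * (n + 1))
    have h2 : HasDerivAt (fun y : ℝ => y * (n + 1)) ((n : ℝ) + 1) y := by
      simpa using (hasDerivAt_id y).mul_const ((n : ℝ) + 1)
    have h3 := (h1.comp y h2).div_const ((n : ℝ) + 1)
    refine (h3.congr_of_eventuallyEq (Eventually.of_forall fun z => by
      simp [hterm, Function.comp])).congr_deriv ?_
    rw [mul_div_cancel_right₀ _ hn.ne', hW]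
  have hsumm := summable_sinc_sq_div hδ
  have hyI : δ ∈ Set.Ioi (δ / 2) := by simp only [Set.mem_Ioi]; linarith
  have hF := hasDerivAt_tsum_of_isPreconnected (t := Ioi (δ / 2)) (y₀ := δ) (y := δ)
    (u := fun n : ℕ => 6 / (1 + (δ / 2) ^ 2 * ((n : ℝ) + 1) ^ 2)) ?_
    isOpen_Ioi isPreconnected_Ioi (fun n z _ => hderiv n z) ?_ hyI hsumm hyI
  · refine (hF.congr_of_eventuallyEq (Eventually.of_forall fun z => by simp [hterm])).congr_deriv ?_
    refine tsum_congr fun n => ?_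
    simp only [hW]
  · have : Summable fun n : ℕ => 6 / (δ / 2) ^ 2 * (1 / ((n : ℝ) + 1) ^ 2) := by
      have := (summable_nat_add_iff 1 |>.2 (Real.summable_one_div_nat_pow.2 one_lt_two)).mul_left
        (6 / (δ / 2) ^ 2)
      refine this.congr fun n => ?_
      push_cast; ring_nf
    refine Summable.of_nonneg_of_le (fun n => by positivity) (fun n => ?_) this
    have hpos : 0 < (δ / 2) ^ 2 * ((n : ℝ) + 1) ^ 2 := by positivity
    have heq : 6 / (δ / 2) ^ 2 * (1 / ((n : ℝ) + 1) ^ 2) = 6 / ((δ / 2) ^ 2 * ((n : ℝ) + 1) ^ 2) := by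
      rw [mul_one_div, div_div]
    rw [heq]
    exact div_le_div_of_nonneg_left (by positivity) hpos (by linarith)
  · intro n z hz
    rw [Real.norm_eq_abs, hW]
    simp only [abs_neg]
    refine (abs_sinc_sq_deriv_le_div_one_add_sq _).trans ?_
    apply div_le_div_of_nonneg_left (by positivity) (by positivity)
    have hz' : δ / 2 < z := hz
    have : (δ / 2) ^ 2 * ((n : ℝ) + 1) ^ 2 ≤ (z * (n + 1)) ^ 2 := by
      rw [mul_pow]; gcongr
    linarith

/-- `s ↦ Σ K'(s(n+1))` is continuous on `[δ, ∞)` for `δ > 0` (locally uniform convergence).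
[cite: Ramare2001LOneApproximateFormulae, Lemma 17 p. 260 (proof)] -/
theorem continuousOn_tsum_sinc_sq_deriv {δ : ℝ} (hδ : 0 < δ) :
    ContinuousOn (fun s : ℝ => ∑' n : ℕ,
      -(4 * π * ∫ t in (0:ℝ)..1, (1 - t) * t * Real.sin (2 * π * (s * (n + 1)) * t))) (Ici δ) := by
  refine continuousOn_tsum (u := fun n : ℕ => 6 / (1 + δ ^ 2 * ((n : ℝ) + 1) ^ 2))
    (fun n => ?_) ?_ (fun n s hs => ?_)
  · refine Continuous.continuousOn ?_
    refine (Continuous.mul continuous_const ?_).neg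
    have hc : Continuous (Function.uncurry fun (s t : ℝ) =>
        (1 - t) * t * Real.sin (2 * π * (s * ((n:ℝ) + 1)) * t)) := by fun_prop
    exact intervalIntegral.continuous_parametric_intervalIntegral_of_continuous' hc 0 1
  · have : Summable fun n : ℕ => 6 / δ ^ 2 * (1 / ((n : ℝ) + 1) ^ 2) := by
      have := (summable_nat_add_iff 1 |>.2 (Real.summable_one_div_nat_pow.2 one_lt_two)).mul_left
        (6 / δ ^ 2)
      refine this.congr fun n => ?_
      push_cast; ring_nf
    refine Summable.of_nonneg_of_le (fun n => by positivity) (fun n => ?_) this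
    have hpos : 0 < δ ^ 2 * ((n : ℝ) + 1) ^ 2 := by positivity
    rw [mul_one_div, div_div]
    exact div_le_div_of_nonneg_left (by positivity) hpos (by linarith)
  · have hs' : δ ≤ s := hs
    rw [Real.norm_eq_abs, abs_neg]
    refine (abs_sinc_sq_deriv_le_div_one_add_sq _).trans ?_
    apply div_le_div_of_nonneg_left (by positivity) (by positivity)
    have : δ ^ 2 * ((n : ℝ) + 1) ^ 2 ≤ (s * (n + 1)) ^ 2 := by
      rw [mul_pow]; gcongr
    linarith

/-- `f(1) = 0`: `K(n) = 0` for every positive integer `n`. [cite: Ramare2001LOneApproximateFormulae, Lemma 17 p. 260 (proof)] -/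
theorem tsum_sinc_sq_div_one : ∑' n : ℕ, Real.sinc (π * (1 * ((n:ℝ) + 1))) ^ 2 / (n + 1) = 0 := by
  refine (tsum_congr fun n => ?_).trans tsum_zero
  have hne : π * ((n:ℝ) + 1) ≠ 0 := by positivity
  rw [one_mul, Real.sinc_of_ne_zero hne, show π * ((n:ℝ) + 1) = ((n + 1 : ℕ) : ℝ) * π by push_cast; ring,
    Real.sin_nat_mul_pi]
  simp

/-! ## Integration in `δ`: `f(δ) = 2∫₀¹(1−t) log sin(πt) dt − 2∫₀¹(1−t) log sin(πδt) dt` -/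

/-- The inner `s`-integral: for `0 < δ ≤ 1` and `t ∈ (0,1)`,
`∫_δ^1 (1−t)t cot(πst) ds = (1−t)(log sin(πt) − log sin(πδt))/π`.
[cite: Ramare2001LOneApproximateFormulae, Lemma 17 p. 260 (proof)] -/
theorem integral_kernel_ds {δ t : ℝ} (hδ : 0 < δ) (hδ1 : δ ≤ 1) (ht : t ∈ Ioo (0:ℝ) 1) :
    ∫ s in δ..1, (1 - t) * t * Real.cos (π * (s * t)) / Real.sin (π * (s * t))
      = (1 - t) * (Real.log (Real.sin (π * t)) - Real.log (Real.sin (π * (δ * t)))) / π := by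
  have hsin : ∀ s ∈ uIcc δ 1, 0 < Real.sin (π * (s * t)) := by
    intro s hs
    rw [uIcc_of_le hδ1] at hs
    have hs0 : 0 < s := lt_of_lt_of_le hδ hs.1
    have ht0 := ht.1
    apply Real.sin_pos_of_pos_of_lt_pi (by positivity)
    have hst : s * t < 1 := by
      calc s * t ≤ 1 * t := mul_le_mul_of_nonneg_right hs.2 ht.1.le
        _ = t := one_mul t
        _ < 1 := ht.2
    exact mul_lt_of_lt_one_right Real.pi_pos hst
  have hderiv : ∀ s ∈ uIcc δ 1, HasDerivAt
      (fun s => (1 - t) * Real.log (Real.sin (π * (s * t))) / π)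
      ((1 - t) * t * Real.cos (π * (s * t)) / Real.sin (π * (s * t))) s := by
    intro s hs
    have h1 : HasDerivAt (fun s : ℝ => Real.sin (π * (s * t))) (Real.cos (π * (s * t)) * (π * t)) s := by
      have := ((hasDerivAt_id s).mul_const t |>.const_mul π).sin
      simpa using this
    have h2 := ((h1.log (hsin s hs).ne').const_mul (1 - t)).div_const π
    refine h2.congr_deriv ?_
    field_simp
  have hcont : ContinuousOn (fun s => (1 - t) * t * Real.cos (π * (s * t)) / Real.sin (π * (s * t)))
      (uIcc δ 1) := by
    refine ContinuousOn.div (by fun_prop) (by fun_prop) fun s hs => (hsin s hs).ne'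
  rw [intervalIntegral.integral_eq_sub_of_hasDerivAt hderiv hcont.intervalIntegrable]
  ring

/-- **Lemma 17, integrated form**: for `0 < δ < 1`,
`Σ_{n≥1} K(δn)/n = 2∫₀¹ (1−t) log sin(πt) dt − 2∫₀¹ (1−t) log sin(πδt) dt`.
[cite: Ramare2001LOneApproximateFormulae, Lemma 17 p. 260] -/
theorem tsum_sinc_sq_div_eq_integral {δ : ℝ} (hδ : 0 < δ) (hδ1 : δ < 1) :
    ∑' n : ℕ, Real.sinc (π * (δ * (n + 1))) ^ 2 / (n + 1)
      = 2 * (∫ t in (0:ℝ)..1, (1 - t) * Real.log (Real.sin (π * t)))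
        - 2 * ∫ t in (0:ℝ)..1, (1 - t) * Real.log (Real.sin (π * (δ * t))) := by
  set f : ℝ → ℝ := fun y => ∑' n : ℕ, Real.sinc (π * (y * (n + 1))) ^ 2 / (n + 1) with hf
  set fd : ℝ → ℝ := fun s => ∑' n : ℕ,
    -(4 * π * ∫ t in (0:ℝ)..1, (1 - t) * t * Real.sin (2 * π * (s * (n + 1)) * t)) with hfd
  set F : ℝ → ℝ → ℝ := fun s t => (1 - t) * t * Real.cos (π * (s * t)) / Real.sin (π * (s * t)) with hF
  -- FTC in `δ`
  have hftc : ∫ s in δ..1, fd s = f 1 - f δ := by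
    refine intervalIntegral.integral_eq_sub_of_hasDerivAt (fun s hs => ?_) ?_
    · rw [uIcc_of_le hδ1.le] at hs
      exact hasDerivAt_tsum_sinc_sq_div (lt_of_lt_of_le hδ hs.1)
    · exact ((continuousOn_tsum_sinc_sq_deriv hδ).mono (by
        rw [uIcc_of_le hδ1.le]; exact Icc_subset_Ici_self)).intervalIntegrable
  have hf1 : f 1 = 0 := tsum_sinc_sq_div_one
  -- `fd = φ` on `[δ, 1)`
  have hfdφ : ∫ s in δ..1, fd s = ∫ s in δ..1, -(2 * π * ∫ t in (0:ℝ)..1, F s t) := by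
    have hae : ∀ᵐ s : ℝ, s ≠ 1 := by rw [ae_iff]; simp
    refine intervalIntegral.integral_congr_ae ?_
    filter_upwards [hae] with s hs1 hs
    rw [uIoc_of_le hδ1.le] at hs
    have hs' : s < 1 := lt_of_le_of_ne hs.2 hs1
    exact (hasSum_sinc_sq_deriv (lt_trans hδ hs.1) hs').tsum_eq
  -- Fubini
  have hbound : ∀ s ∈ Ioc δ 1, ∀ t ∈ Ioc (0:ℝ) 1, |F s t| ≤ 1 / (2 * δ) := by
    intro s hs t ht
    rcases ht.2.eq_or_lt with h1 | h1
    · rw [h1]; simp [hF]; positivity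
    · have hs0 : 0 < s := lt_trans hδ hs.1
      have := abs_kernel_div_sin_le hs0 hs.2 ⟨ht.1, h1⟩ (Real.abs_cos_le_one (π * (s * t)))
      simp only [hF]
      refine this.trans ?_
      exact div_le_div_of_nonneg_left (by norm_num) (by positivity) (by linarith [hs.1])
  have hFm : Measurable (Function.uncurry F) := by simp only [hF]; fun_prop
  have hFi : Integrable (Function.uncurry F)
      ((volume.restrict (Ioc δ 1)).prod (volume.restrict (Ioc (0:ℝ) 1))) := by
    rw [Measure.prod_restrict]
    refine Measure.integrableOn_of_bounded (M := 1 / (2 * δ)) ?_ hFm.aestronglyMeasurable ?_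
    · rw [Measure.prod_prod]; simp
    · rw [ae_restrict_iff' (measurableSet_Ioc.prod measurableSet_Ioc)]
      refine Eventually.of_forall fun p hp => ?_
      rw [Real.norm_eq_abs]
      exact hbound p.1 hp.1 p.2 hp.2
  have hswap : ∫ s in δ..1, (∫ t in (0:ℝ)..1, F s t) = ∫ t in (0:ℝ)..1, (∫ s in δ..1, F s t) := by
    simp only [intervalIntegral.integral_of_le hδ1.le, intervalIntegral.integral_of_le zero_le_one]
    exact MeasureTheory.integral_integral_swap hFi
  -- inner integral
  have hinner : ∫ t in (0:ℝ)..1, (∫ s in δ..1, F s t)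
      = ∫ t in (0:ℝ)..1, (1 - t) * (Real.log (Real.sin (π * t)) - Real.log (Real.sin (π * (δ * t)))) / π := by
    have hae : ∀ᵐ t : ℝ, t ≠ 1 := by rw [ae_iff]; simp
    refine intervalIntegral.integral_congr_ae ?_
    filter_upwards [hae] with t ht1 ht
    rw [uIoc_of_le zero_le_one] at ht
    exact integral_kernel_ds hδ hδ1.le ⟨ht.1, lt_of_le_of_ne ht.2 ht1⟩
  -- integrability of the log-sin pieces
  have hL1 : IntervalIntegrable (fun t => (1 - t) * Real.log (Real.sin (π * t))) volume 0 1 := by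
    have h := (intervalIntegrable_log_sin (a := 0) (b := π)).comp_mul_left (c := π)
    have h' : IntervalIntegrable (fun t => Real.log (Real.sin (π * t))) volume 0 1 := by
      simpa [Real.pi_ne_zero] using h
    exact h'.continuousOn_mul (by fun_prop)
  have hL2 : IntervalIntegrable (fun t => (1 - t) * Real.log (Real.sin (π * (δ * t)))) volume 0 1 := by
    have h := (intervalIntegrable_log_sin (a := 0) (b := π * δ)).comp_mul_left (c := π * δ)
    have hπδ : π * δ ≠ 0 := by positivity
    have h' : IntervalIntegrable (fun t => Real.log (Real.sin (π * (δ * t)))) volume 0 1 := by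
      have e : (fun t => Real.log (Real.sin (π * (δ * t)))) = fun t => (Real.log ∘ Real.sin) (π * δ * t) := by
        funext t; simp [mul_assoc]
      rw [e]; simpa [hπδ] using h
    exact h'.continuousOn_mul (by fun_prop)
  -- assemble
  have hval : ∫ t in (0:ℝ)..1, (1 - t) * (Real.log (Real.sin (π * t)) -
      Real.log (Real.sin (π * (δ * t)))) / π
      = ((∫ t in (0:ℝ)..1, (1 - t) * Real.log (Real.sin (π * t)))
        - ∫ t in (0:ℝ)..1, (1 - t) * Real.log (Real.sin (π * (δ * t)))) / π := by
    rw [← intervalIntegral.integral_sub hL1 hL2, ← intervalIntegral.integral_div]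
    refine intervalIntegral.integral_congr fun t _ => by ring
  have hφint : ∫ s in δ..1, -(2 * π * ∫ t in (0:ℝ)..1, F s t)
      = -(2 * π) * ∫ s in δ..1, (∫ t in (0:ℝ)..1, F s t) := by
    rw [← intervalIntegral.integral_const_mul]
    refine intervalIntegral.integral_congr fun s _ => by ring
  have key : f δ = -(∫ s in δ..1, fd s) := by linarith [hftc, hf1]
  set I1 : ℝ := ∫ t in (0:ℝ)..1, (1 - t) * Real.log (Real.sin (π * t)) with hI1
  set I2 : ℝ := ∫ t in (0:ℝ)..1, (1 - t) * Real.log (Real.sin (π * (δ * t))) with hI2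
  rw [show (∑' n : ℕ, Real.sinc (π * (δ * (n + 1))) ^ 2 / (n + 1)) = f δ from rfl, key, hfdφ, hφint,
    hswap, hinner, hval]
  field_simp

/-- `2∫₀¹ (1−t) log sin(πt) dt = −log 2` (symmetry `t ↦ 1−t` and Mathlib's `∫₀^π log sin = −π log 2`).
[cite: Ramare2001LOneApproximateFormulae, (5.6) p. 260] -/
theorem two_mul_integral_one_sub_mul_log_sin :
    2 * ∫ t in (0:ℝ)..1, (1 - t) * Real.log (Real.sin (π * t)) = -Real.log 2 := by
  set L : ℝ → ℝ := fun t => Real.log (Real.sin (π * t)) with hL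
  have hLi : IntervalIntegrable L volume 0 1 := by
    have h := (intervalIntegrable_log_sin (a := 0) (b := π)).comp_mul_left (c := π)
    simpa [hL, Real.pi_ne_zero] using h
  have hsym : ∫ t in (0:ℝ)..1, (1 - t) * L t = ∫ t in (0:ℝ)..1, t * L t := by
    have h := intervalIntegral.integral_comp_sub_left (fun u => u * L (1 - u)) (1:ℝ) (a := 0) (b := 1)
    simp only [sub_sub_cancel, sub_self, sub_zero] at h
    -- h : ∫ x in 0..1, (1 - x) * L (1 - (1 - x)) = ∫ x in 0..1, x * L (1 - x)
    have hLsym : ∀ u, L (1 - u) = L u := fun u => by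
      simp only [hL]; rw [mul_sub, mul_one, Real.sin_pi_sub]
    simp only [hLsym] at h
    exact h
  have hsum : (∫ t in (0:ℝ)..1, (1 - t) * L t) + ∫ t in (0:ℝ)..1, t * L t = ∫ t in (0:ℝ)..1, L t := by
    rw [← intervalIntegral.integral_add (hLi.continuousOn_mul (by fun_prop))
      (hLi.continuousOn_mul (by fun_prop))]
    refine intervalIntegral.integral_congr fun t _ => by ring
  have hint : ∫ t in (0:ℝ)..1, L t = -Real.log 2 := by
    have h := intervalIntegral.integral_comp_mul_left (fun x => Real.log (Real.sin x)) (a := 0) (b := 1)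
      Real.pi_ne_zero
    simp only [mul_zero, mul_one] at h
    rw [hL]
    simp only
    rw [h, integral_log_sin_zero_pi, smul_eq_mul]
    field_simp
  linarith

/-- `u − u³/6 ≤ sin u` for `u ≥ 0` («`x − sin x ≤ x³/6`» in the proof of Lemma 18).
[cite: Ramare2001LOneApproximateFormulae, Lemma 18 p. 261 (proof)] -/
theorem sub_cube_div_six_le_sin {u : ℝ} (hu : 0 ≤ u) : u - u ^ 3 / 6 ≤ Real.sin u := by
  let g : ℝ → ℝ := fun u => Real.sin u - (u - u ^ 3 / 6)
  have hderiv : ∀ x : ℝ, HasDerivAt g (Real.cos x - (1 - x ^ 2 / 2)) x := by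
    intro x
    have := (Real.hasDerivAt_sin x).sub ((hasDerivAt_id x).sub ((hasDerivAt_pow 3 x).div_const 6))
    refine this.congr_deriv ?_
    simp; ring
  have hmono : MonotoneOn g (Ici 0) := by
    refine monotoneOn_of_deriv_nonneg (convex_Ici 0) ?_ ?_ fun x _ => ?_
    · exact (continuous_iff_continuousAt.2 fun x => (hderiv x).continuousAt).continuousOn
    · exact fun x _ => (hderiv x).differentiableAt.differentiableWithinAt
    · rw [(hderiv x).deriv]; linarith [Real.one_sub_sq_div_two_le_cos (x := x)]
  have h := hmono (self_mem_Ici : (0:ℝ) ∈ Ici 0) hu hu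
  simp only [g, Real.sin_zero] at h
  linarith

/-- `∫₀¹ t log t dt = −1/4`. [folklore] -/
private theorem integral_id_mul_log : ∫ t in (0:ℝ)..1, t * Real.log t = -1 / 4 := by
  have hcont : ContinuousOn (fun t : ℝ => t / 2 * (t * Real.log t) - t ^ 2 / 4) (Icc 0 1) := by
    have := Real.continuous_mul_log
    fun_prop
  have hderiv : ∀ t ∈ Ioo (0:ℝ) 1,
      HasDerivAt (fun t : ℝ => t / 2 * (t * Real.log t) - t ^ 2 / 4) (t * Real.log t) t := by
    intro t ht
    have h := (((hasDerivAt_id t).div_const 2).mul (Real.hasDerivAt_mul_log ht.1.ne')).sub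
      ((hasDerivAt_pow 2 t).div_const 4)
    refine h.congr_deriv ?_
    simp only [id, Nat.cast_ofNat]
    ring
  rw [intervalIntegral.integral_eq_sub_of_hasDerivAt_of_le zero_le_one hcont hderiv
    ((intervalIntegrable_log'.continuousOn_mul (by fun_prop)))]
  norm_num

/-- **The log-sine integral bound**: for `0 < x` with `x² < 6`,
`−2∫₀¹ (1−t) log sin(xt) dt ≤ −log x + 3/2 + x²/(6(6 − x²))` (from `sin u ≥ u − u³/6`).
[cite: Ramare2001LOneApproximateFormulae, Lemma 18 p. 261] -/
theorem neg_two_mul_integral_log_sin_le {x : ℝ} (hx : 0 < x) (hx6 : x ^ 2 < 6) :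
    -(2 * ∫ t in (0:ℝ)..1, (1 - t) * Real.log (Real.sin (x * t)))
      ≤ -Real.log x + 3 / 2 + x ^ 2 / (6 * (6 - x ^ 2)) := by
  set c : ℝ := x ^ 2 / (6 - x ^ 2) with hc
  have hc0 : 0 ≤ c := div_nonneg (sq_nonneg _) (by linarith)
  -- integrability
  have hL : IntervalIntegrable (fun t => (1 - t) * Real.log (Real.sin (x * t))) volume 0 1 := by
    have h := (intervalIntegrable_log_sin (a := 0) (b := x)).comp_mul_left (c := x)
    have h' : IntervalIntegrable (fun t => Real.log (Real.sin (x * t))) volume 0 1 := by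
      simpa [hx.ne'] using h
    exact h'.continuousOn_mul (by fun_prop)
  set g : ℝ → ℝ := fun t => (1 - t) * (Real.log x + Real.log t) - c * ((1 - t) * t ^ 2) with hg
  have hgi : IntervalIntegrable g volume 0 1 := by
    simp only [hg]
    refine IntervalIntegrable.sub ?_ ((by fun_prop : Continuous fun t : ℝ => c * ((1 - t) * t ^ 2)).intervalIntegrable _ _)
    have h1 : IntervalIntegrable (fun t => Real.log x + Real.log t) volume 0 1 :=
      intervalIntegrable_const.add intervalIntegrable_log'
    exact h1.continuousOn_mul (by fun_prop)
  -- pointwise inequality on `(0,1]`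
  have hpt : ∀ t ∈ Ioc (0:ℝ) 1, g t ≤ (1 - t) * Real.log (Real.sin (x * t)) := by
    intro t ht
    have hu : 0 < x * t := mul_pos hx ht.1
    have hu2 : (x * t) ^ 2 ≤ x ^ 2 := by
      rw [mul_pow]; exact mul_le_of_le_one_right (sq_nonneg _) (by nlinarith [ht.1, ht.2])
    have hy : 0 < 1 - (x * t) ^ 2 / 6 := by nlinarith
    have hsin : (x * t) * (1 - (x * t) ^ 2 / 6) ≤ Real.sin (x * t) := by
      have := sub_cube_div_six_le_sin hu.le; nlinarith
    have hsinpos : 0 < Real.sin (x * t) := lt_of_lt_of_le (by positivity) hsin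
    have hlog : Real.log (x * t) + Real.log (1 - (x * t) ^ 2 / 6) ≤ Real.log (Real.sin (x * t)) := by
      rw [← Real.log_mul hu.ne' hy.ne']
      exact Real.log_le_log (by positivity) hsin
    have hlog2 : -(t ^ 2 * c) ≤ Real.log (1 - (x * t) ^ 2 / 6) := by
      have h := Real.one_sub_inv_le_log_of_pos hy
      have hne : 6 - x ^ 2 * t ^ 2 ≠ 0 := by nlinarith
      have hne' : 6 - (x * t) ^ 2 ≠ 0 := by nlinarith
      have h2 : 1 - (1 - (x * t) ^ 2 / 6)⁻¹ = -((x * t) ^ 2 / (6 - (x * t) ^ 2)) := by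
        rw [mul_pow]
        field_simp
        ring
      rw [h2] at h
      have h3 : (x * t) ^ 2 / (6 - (x * t) ^ 2) ≤ t ^ 2 * c := by
        rw [hc, mul_pow, mul_div_assoc']
        rw [div_le_iff₀ (by nlinarith), show t ^ 2 * x ^ 2 / (6 - x ^ 2) * (6 - x ^ 2 * t ^ 2)
          = t ^ 2 * x ^ 2 * ((6 - x ^ 2 * t ^ 2) / (6 - x ^ 2)) by ring]
        have : 1 ≤ (6 - x ^ 2 * t ^ 2) / (6 - x ^ 2) := by
          rw [le_div_iff₀ (by linarith)]; nlinarith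
        nlinarith [mul_nonneg (sq_nonneg t) (sq_nonneg x)]
      linarith
    have hxt : Real.log (x * t) = Real.log x + Real.log t := Real.log_mul hx.ne' ht.1.ne'
    simp only [hg]
    have h1t : 0 ≤ 1 - t := by linarith [ht.2]
    nlinarith [mul_le_mul_of_nonneg_left (show Real.log x + Real.log t - t ^ 2 * c ≤
      Real.log (Real.sin (x * t)) by linarith) h1t]
  have hmono : ∫ t in (0:ℝ)..1, g t ≤ ∫ t in (0:ℝ)..1, (1 - t) * Real.log (Real.sin (x * t)) := by
    refine intervalIntegral.integral_mono_ae_restrict zero_le_one hgi hL ?_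
    have hae : ∀ᵐ t : ℝ, t ≠ 0 := by rw [ae_iff]; simp
    rw [Filter.EventuallyLE, ae_restrict_iff' measurableSet_Icc]
    filter_upwards [hae] with t ht0 ht
    exact hpt t ⟨lt_of_le_of_ne ht.1 (Ne.symm ht0), ht.2⟩
  -- the value of `∫ g`
  have hgval : ∫ t in (0:ℝ)..1, g t = (Real.log x) / 2 - 3 / 4 - c / 12 := by
    have e1 : ∫ t in (0:ℝ)..1, g t = (∫ t in (0:ℝ)..1, (1 - t) * (Real.log x + Real.log t))
        - ∫ t in (0:ℝ)..1, c * ((1 - t) * t ^ 2) := by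
      simp only [hg]
      rw [intervalIntegral.integral_sub]
      · exact (intervalIntegrable_const.add intervalIntegrable_log').continuousOn_mul (by fun_prop)
      · exact (by fun_prop : Continuous fun t : ℝ => c * ((1 - t) * t ^ 2)).intervalIntegrable _ _
    have e2 : ∫ t in (0:ℝ)..1, (1 - t) * (Real.log x + Real.log t)
        = Real.log x / 2 - 3 / 4 := by
      have e : (fun t : ℝ => (1 - t) * (Real.log x + Real.log t))
          = fun t => (Real.log x + (Real.log t - t * Real.log t)) - Real.log x * t := by
        funext t; ring
      rw [e, intervalIntegral.integral_sub, intervalIntegral.integral_add, intervalIntegral.integral_sub,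
        intervalIntegral.integral_const, integral_log, integral_id_mul_log,
        intervalIntegral.integral_const_mul, integral_id]
      · simp; ring
      · exact intervalIntegrable_log'
      · exact intervalIntegrable_log'.continuousOn_mul (by fun_prop)
      · exact intervalIntegrable_const
      · exact intervalIntegrable_log'.sub (intervalIntegrable_log'.continuousOn_mul (by fun_prop))
      · exact intervalIntegrable_const.add
          (intervalIntegrable_log'.sub (intervalIntegrable_log'.continuousOn_mul (by fun_prop)))
      · exact (by fun_prop : Continuous fun t : ℝ => Real.log x * t).intervalIntegrable _ _
    have e3 : ∫ t in (0:ℝ)..1, c * ((1 - t) * t ^ 2) = c / 12 := by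
      have e : (fun t : ℝ => c * ((1 - t) * t ^ 2)) = fun t => c * t ^ 2 - c * t ^ 3 := by
        funext t; ring
      rw [e, intervalIntegral.integral_sub, intervalIntegral.integral_const_mul,
        intervalIntegral.integral_const_mul, integral_pow, integral_pow]
      · norm_num; ring
      · exact (by fun_prop : Continuous fun t : ℝ => c * t ^ 2).intervalIntegrable _ _
      · exact (by fun_prop : Continuous fun t : ℝ => c * t ^ 3).intervalIntegrable _ _
    rw [e1, e2, e3]
  rw [hgval] at hmono
  have : x ^ 2 / (6 * (6 - x ^ 2)) = c / 6 := by rw [hc]; field_simp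
  rw [this]
  linarith

/-- **Ramaré's Lemma 17 (with Lemma 18), upper-bound form**: for `0 < δ ≤ 1/2`,
`Σ_{n≥1} K(δn)/n ≤ −log(2πδ) + 3/2 + (πδ)²/(6(6 − (πδ)²))`
(Ramaré: `= −log δ + 3/2 − log 2π + 2∫₀¹(1−t)log(πδt/sin πδt)dt`, and the last integral is
`≤ π³δ²/12`).  [cite: Ramare2001LOneApproximateFormulae, Lemma 17 p. 260] -/
theorem tsum_sinc_sq_div_le {δ : ℝ} (hδ : 0 < δ) (hδ1 : δ ≤ 1 / 2) :
    ∑' n : ℕ, Real.sinc (π * (δ * (n + 1))) ^ 2 / (n + 1)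
      ≤ -Real.log (2 * π * δ) + 3 / 2 + (π * δ) ^ 2 / (6 * (6 - (π * δ) ^ 2)) := by
  have hδ1' : δ < 1 := by linarith
  have hx : 0 < π * δ := by positivity
  have hx6 : (π * δ) ^ 2 < 6 := by
    have h1 : π * δ ≤ π * (1 / 2) := mul_le_mul_of_nonneg_left hδ1 Real.pi_pos.le
    have h2 : π * δ < 2 := by linarith [Real.pi_lt_d2]
    nlinarith [mul_pos hx (sub_pos.2 h2)]
  rw [tsum_sinc_sq_div_eq_integral hδ hδ1', two_mul_integral_one_sub_mul_log_sin]
  have h := neg_two_mul_integral_log_sin_le hx hx6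
  have e : (∫ t in (0:ℝ)..1, (1 - t) * Real.log (Real.sin (π * (δ * t))))
      = ∫ t in (0:ℝ)..1, (1 - t) * Real.log (Real.sin (π * δ * t)) :=
    intervalIntegral.integral_congr fun t _ => by rw [mul_assoc]
  have hlog : Real.log (2 * π * δ) = Real.log 2 + Real.log (π * δ) := by
    rw [mul_assoc, Real.log_mul two_ne_zero hx.ne']
  rw [e, hlog]
  linarith

end Literature.Analysis.Fourier
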